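import Literature.MathematicalPhysics.QuantumFieldTheory.Balaban1983to89.B7Eq167General
import Literature.MathematicalPhysics.QuantumFieldTheory.Balaban1983to89.B7Prop1Local
import Literature.MathematicalPhysics.QuantumFieldTheory.Balaban1983to89.B15PrelimIntegrations

/-!
# `Balaban1983to89.B15Ineq137Proof` — T. Bałaban, *Large field renormalization. I. The basic step of the 𝐑
# operation*, Commun. Math. Phys. **122** (1989) 175–202 [Balaban1989LargeFieldI], (1.37) p. 184
# *"|exp iℍ^{(j)}(b) − 1| ≦ O(1)L · sup_{B^j(b₋)∪B^j(b₊)} |ℍ|"* — the `[12]`-part PROVED for the concrete `j`-fold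
# average on `ℤ^d` (Proposition 6 (164) of [12] at a general regular background, tree `B7Eq162General.eq164_general`,
# LOCALISED to the two blocks by `B7Prop1Local.avgIter_congr`), and r12's leaf `B15.PrelimIntegrations.Ineq137`
# DISCHARGED with an explicit `O(1)` modulo the printed-regime smallness of the gauge transformation `u_j` of (1.34)

statement-level skeleton of published theorems with citation tags; proofs where landed; nothing here is a claim
about the Yang–Mills mass gap

PDF held: `paper:balaban1989-cmp122-large-field-i` (journal page = PDF page + 174); p. 184 [PDF 10] READ AS AN IMAGE
on the x2 render `run/shared/lean/pub/pub-balaban/b2b-balaban-ref1/pages/1989-cmp122-large-field-I/…-p010-x2.png`.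
"[12]" = [Balaban1985Averaging] (CMP **98**): (159)–(164) pp. 42–43, in the tree AT A GENERAL REGULAR BACKGROUND as
`B7Eq162General.eq164_general` (seat p06 gen 2; with (161) = `B7Eq123General.prop4_general`, (162)/(163) =
`B7Eq162General.eq162_general`/`eq163_general`, (159) = `B7Eq92Concrete.val_avgIter_mul_eq`); the locality of the
`k`-fold average (p. 24 of [12]) = `B7Prop1Local.avgIter_congr`.

WHAT IS REPRODUCED.  SKELETON row **B15.Eq1.37** (mega-formalization `lit-balaban`, HOME
`run/shared/lean/pub/lit-balaban/`, Phase-2 proof seat `p29` gen 6, unit `lit-balaban-p29`; rows of record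
`lit-balaban-r12/ROWS-B15.md`: `typed p239014` as the real leaf `Ineq137 dev C L supH := dev ≤ C·L·supH`; r12's
`B15SmallField185` consumes (1.37) only through the hypothesis "its left-hand side ≤ ½δ_j").  THE PRINTED TEXT (p. 184,
verbatim from the render): *"Now we represent the configuration U(·) in the standard way, as in (1.30)
U(𝔹(Z_{j+1}∖Z_j)∪𝔹_k, M˙(Q^{s*}V)) = U(𝔹(Z_{j+1}∖Z_j)∪𝔹_k, [M˙(Q^{s*}V)(M˙(U^{(n+1)}_k))⁻¹]M˙(U^{(n+1)}_k))
= (exp iξℍ(𝔹(Z_{j+1}∖Z_j)∪𝔹_k, −(1/i) log[M˙(U^{(n+1)}_k)(M˙(Q^{s*}V))⁻¹]) U^{(n+1)}_k)^{u_j⁻¹}. (1.34)  This implies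
V^{(j)}_{Z_{j+1}∖Z_j} = (M̃^j(exp iξℍ)M^j(U^{(n+1)}_k))^{u_j⁻¹} = exp iℍ^{(j)}V_Z^{(j)}, (1.35) where
exp iℍ^{(j)}(b) = u_j⁻¹(b₋) exp iQ̃_j(ξℍ, b) R̄^j(u_j(b₊)). (1.36)  From the equalities and bounds (106)–(108), (159)–(163)
in [12] we obtain  |exp iℍ^{(j)}(b) − 1| ≦ O(1)L · sup_{B^j(b₋)∪B^j(b₊)} |ℍ|. (1.37)"*; with `V_Z^{(j)} = M^j(U^{(j+1−h)}_{k,Z})`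
((1.26) p. 182), `ξ = L^{−j}` (p. 183 l. −2), `M^j` the `j`-fold average (43) of [12], `M̃^j(e^{iξℍ})M^j(U) = M^j(e^{iξℍ}U)`
((69) of [12]), `R̄^j(u) = M^j(U)(b)·u·M^j(U)(b)⁻¹` ((56)/(78) of [12]).

THE ARGUMENT FORMALISED.  Write `U₀ = U^{(n+1)}_k`, `B = iξℍ` (bondwise exponent), `Ū₀ʲ = M^j(U₀)`.  By (1.35)/(1.36),
`exp iℍ^{(j)}(b) = u_j(b₋)⁻¹·[M^j(e^{B}U₀)(b)·Ū₀ʲ(b)⁻¹]·[Ū₀ʲ(b)u_j(b₊)Ū₀ʲ(b)⁻¹]`, and the middle factor `Ũ′ʲ_b =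
exp iQ̃_j(ξℍ, b)` — the tilde average (69) of [12], frames (159)–(163) included — is EXACTLY the quantity of Proposition 6
(164) of [12]: at a general regular background (`U₀` with values in an averaging-closed `G ⊂ {|u| ≤ 1, |u⁻¹| ≤ 1}` and
(52) `sup_p|U₀(∂p) − 1| < α₀L^{−2j}`), for `sup|B| ≤ b` small, `|M^j(e^{B}U₀)(b)Ū₀ʲ(b)⁻¹ − 1| ≤ 136(d+1)·Lʲb`
(`B7Eq162General.eq164_general`).  LOCALITY (print's sup over `B^j(b₋)∪B^j(b₊)`): both averages at `b = ⟨q, q + e_κ⟩`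
depend only on the bond variables in the box `[Lʲq, Lʲq + (Lʲ − 1)𝟙 + Lʲe_κ]` (`B7Prop1Local.avgIter_congr`, p. 24 of
[12]), so `B` may be replaced by `B∘π` (`π` the nearest-point retraction onto the box, `B7Prop1Local.clamp`), whose GLOBAL
sup is the LOCAL sup `b_loc` of `B` over the bonds issuing from the box (`tilde_le_local`).  In print's letters `B = iξℍ`,
`ξ = L^{−j}`: `Lʲb_loc = sup_{B^j(b₋)∪B^j(b₊)}|ℍ| =: s`, so `|Ũ′ʲ_b − 1| ≤ 136(d+1)·s ≤ 136(d+1)·L·s` (`tilde_le_printed`).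
Finally the two `u_j` factors: with `|u_j(b_±) − 1| ≤ C_u·L·s ≤ 1` (HYPOTHESIS — the smallness of the gauge transformation
of the standard representation (1.34), an input from [III] (2.14)/(3.6) and [15], not from [12]) the unit-ball algebra
`|a·T·c − 1| ≤ |a − 1| + |T − 1| + |c − 1| + |T − 1||c − 1|` gives `|exp iℍ^{(j)}(b) − 1| ≤ (272(d+1) + 2C_u)·L·s`, i.e.
r12's leaf `Ineq137 dev (272(d+1) + 2C_u) L s` (`ineq137_of_164`).

v1.1 (§4, THE `u_j`-HYPOTHESIS DISCHARGED FOR [12]'s GAUGE FIXING).  Print's «(106)–(108) [12]» input is now in the tree at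
a general regular background: `B7Eq167General.norm_glev_sub_one_le` — the gauge fixing `u` of (104)–(106) of [12]
(`B7Eq84Concrete.glev`, the unique solution of the block axial gauge conditions (67) + the averaging condition (81)) for the
small field `e^{B}` at the background `U₀` satisfies `|u(x) − 1| ≤ 40d·Lʲb` at every site ((166) at `j = 0`).  §4 puts the two
halves together: `avgIter_gaugeAct_ratio` is the identity (1.35)/(1.36) in the model — `M^j((e^{B}U₀)^{g})(b)·M^j(U₀)(b)⁻¹ =
g(Lʲb₋)·[M^j(e^{B}U₀)(b)]·g(Lʲb₊)⁻¹·M^j(U₀)(b)⁻¹` (gauge covariance (70) of the `j`-fold average, `B7Prop6Flat.avgIter_gaugeAct_units`);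
`dev_le_of_norm_sub_one_le` is the unit-ball algebra WITHOUT unitarity of `u` (`|u(b_±) − 1| ≤ y ≤ ½`, `|Ũ′ − 1| ≤ t ≤ 1` ⇒
`|u(b₋)⁻¹Ũ′[Ū₀u(b₊)Ū₀⁻¹] − 1| ≤ t + 8y`); **`stdRep_dev_le`** is the generic bound `|M^j((e^{B}U₀)^{u⁻¹})(b)M^j(U₀)(b)⁻¹ − 1| ≤ (136(d+1) + 320d)·Lʲb` for `u = glev(U₀, e^{B})`, `sup|B| ≤ b` (also the shape of [III] (3.19) / [IV] (1.42) with `B = iL⁻¹ξ𝐇_{j+1,□′}`); and **`ineq137_glev`** is (1.37) WITH NO HYPOTHESIS ON `u` LEFT: for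
`B = iξℍ`, `ξ = L^{−j}`, `sup|ℍ| ≤ s` (regime (M2) + `128d·s ≤ 1`… implied by `2048d·s ≤ 1`) and `u := glev(U₀, e^{iξℍ})`,
`|M^j((e^{iξℍ}U₀)^{u⁻¹})(b)·M^j(U₀)(b)⁻¹ − 1| ≤ (136(d+1) + 320d)·s`, i.e. `Ineq137 dev (68 + 228d) L s` (`L ≥ 2`).  READING
(M3′): print's `u_j` is the gauge transformation of the standard representation (1.34) ([15] Thm 1 with the averaging
conditions of [6] Thm 2); the model takes [12]'s block-axial gauge fixing of `e^{iξℍ}` relative to `U₀` — the object for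
which (104)–(108) are printed and kernel-certified; that this is the `u_j` of (1.34) is print's «(106)–(108) [12]» citation
and is not re-derived here.  (M5′) §4 uses the GLOBAL sup `s` of `|ℍ|` for the `u`-part ((106) reads `U̿^m` on the whole
`j`-block tower above `b_±`), the local sup of §2 for the tilde part.

MODEL / DECLARED DEVIATIONS (referee columns F6/F7).  (M1) LATTICE/GROUP: the `B7Prop2Explicit` dictionary — every
level read on `ℤ^d` (`M^j = avgIter L · j`), values in a complete normed `ℂ`-algebra `𝔸` with `‖1‖ = 1`, gauge group an
averaging-closed subgroup `G ⊂ U1` (`AvgClosed`; `U(N)`, `SU(N)` by `B7Prop2Explicit`/`B7Prop2SpecialUnitary`); `B` a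
GENERAL exponent field (print: `iξℍ`, `ℍ` 𝔤-valued — hermiticity is not needed for (164)).  (M2) REGIME made explicit
(print: [12]'s "α₀, α₁ sufficiently small"): Prop. 2's `0 < α₀`, `C₀α₀ ≤ ⅓`, `4α₀ ≤ c₂′(d,L)`, (52) for `U₀ = U^{(n+1)}_k` at
level `j`, and for `s` (playing `Lʲηα₁`) the four smallness conditions of `eq164_general` verbatim (`e^{3200(d+1)²(d+4)α₀}·
(1 + 8·131072(d+1)²s) ≤ 2`, `2s ≤ c₃(d,L)`, `2048ds ≤ 1`, `128s ≤ 1`).  (M3) THE GAUGE TRANSFORMATION `u_j` of (1.34)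
enters only through the hypothesis `|u_j(b_±) − 1| ≤ C_u·L·s ≤ 1`; print's citation "(106)–(108), (159)–(163) in [12]"
covers the tilde factor (PROVED here by name) — the `u_j`-smallness is the standard-representation input.  (M4) print's
`O(1)` is unspecified; here `136(d+1)` for the tilde factor and `272(d+1) + 2C_u` in all; `L ≥ 2` (so `·L` is honest slack
for the tilde factor, print's `L` coming from (162)'s `L^{j+1}`).  (M5) `sup_{B^j(b₋)∪B^j(b₊)}|ℍ|` is read as any bound `s`
of `|ℍ(y, κ′)|` over the bonds `⟨y, y + e_{κ′}⟩` with `y` in the box (the "at least one end-point" bond convention of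
[14] Sect. A).  Net new unproved facts: 0 (theorems only; no `def`).
-/

noncomputable section

open scoped BigOperators
open NormedSpace Finset

namespace Literature.MathematicalPhysics.QuantumFieldTheory.Balaban1983to89.B15Ineq137Proof

open B7Prop1Explicit B7Prop2Explicit B7Prop3Flat B7Eq92Concrete B7Prop1Local B7Eq162General
open B15.PrelimIntegrations (Ineq137)

-- `Site` alone could resolve to the torus sites of `Setup.lean` through a parent namespace; re-export the `ℤ^d`
-- sites of `B7Prop1Explicit`.
export B7Prop1Explicit (Site)

variable {d : ℕ}
variable {𝔸 : Type*} [NormedRing 𝔸] [NormedAlgebra ℂ 𝔸] [CompleteSpace 𝔸] [NormOneClass 𝔸]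

/-! ## §1 Locality: the exponent field may be clamped to the box `B^j(b₋) ∪ B^j(b₊)` -/

/-- The box of the bond `⟨q, q + e_κ⟩` of the `j`-th lattice is a genuine box: `Lʲq ≤ Lʲq + (Lʲ − 1) + [Lʲ]`
coordinatewise (`L ≥ 1`). [cite: Balaban1985Averaging, p.24 (sentence after (43))] -/
theorem loK_le_bondHiK {L : ℕ} (hL : 1 ≤ L) (j : ℕ) (q : Site d) (κ : Fin d) (i : Fin d) :
    loK L j q i ≤ bondHiK L j q κ i := by
  have hLj : (1 : ℤ) ≤ (L : ℤ) ^ j := by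
    have : (1 : ℤ) ≤ (L : ℤ) := by exact_mod_cast hL
    exact one_le_pow₀ this
  have hite : (0 : ℤ) ≤ (if i = κ then (L : ℤ) ^ j else 0) := by split_ifs <;> linarith
  simp only [loK, bondHiK]
  linarith

omit [NormOneClass 𝔸] in
/-- **LOCALITY** (p. 24 of [12]: *"Ū^k_c … depends only on the bond variables U_b for b ⊂ B^k(c₋) ∪ B^k(c₊)"*): the
`j`-fold average at `⟨q, q + e_κ⟩` of `e^{B}U₀` is unchanged when `B` is replaced by `B∘π`, `π` the retraction onto the
box. [cite: Balaban1985Averaging, p.24 (sentence after (43))] -/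
theorem avgIter_expCfg_mul_clamp {L : ℕ} (hL : 1 ≤ L) (j : ℕ) (U₀ : Site d → Fin d → 𝔸ˣ)
    (B : Site d → Fin d → 𝔸) (q : Site d) (κ : Fin d) :
    avgIter L (expCfg B * U₀) j q κ
      = avgIter L (expCfg (fun x μ => B (clamp (loK L j q) (bondHiK L j q κ) x) μ) * U₀) j q κ :=
  avgIter_congr L hL j q κ fun x μ hx _ => by
    simp only [Pi.mul_apply, expCfg, clamp_of_inBox hx]

omit [NormedAlgebra ℂ 𝔸] [CompleteSpace 𝔸] [NormOneClass 𝔸] in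
/-- The clamped exponent field is bounded EVERYWHERE by the LOCAL bound of `B` over the bonds issuing from the box.
[cite: Balaban1989LargeFieldI, (1.37) p.184] -/
theorem norm_clamp_le {L : ℕ} (hL : 1 ≤ L) {j : ℕ} {q : Site d} {κ : Fin d} {B : Site d → Fin d → 𝔸} {bloc : ℝ}
    (hB : ∀ y μ, InBox (loK L j q) (bondHiK L j q κ) y → ‖B y μ‖ ≤ bloc) (x : Site d) (μ : Fin d) :
    ‖B (clamp (loK L j q) (bondHiK L j q κ) x) μ‖ ≤ bloc :=
  hB _ μ (clamp_inBox (loK_le_bondHiK hL j q κ) x)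

/-! ## §2 The tilde factor: Proposition 6 (164) of [12], localised -/

/-- **(164) of [12] WITH THE PRINTED LOCAL SUP** — for `U₀` with values in an averaging-closed `G ⊂ U1`, Prop. 2's
regularity at level `j` (`0 < α₀`, `C₀α₀ ≤ ⅓`, `4α₀ ≤ c₂′`, `sup_p|U₀(∂p) − 1| < α₀L^{−2j}`), and an exponent field `B`
bounded by `b_loc` on the bonds issuing from the box `B^j(b₋) ∪ B^j(b₊)` of `b = ⟨q, q + e_κ⟩`, under the four smallness
conditions of `eq164_general` for `Lʲb_loc`:  `|M^j(e^{B}U₀)(b)·M^j(U₀)(b)⁻¹ − 1| ≤ 136(d+1)·Lʲb_loc` — the factor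
`exp iQ̃_j(ξℍ, b)` of (1.36), frames (159)–(163) of [12] included. [cite: Balaban1989LargeFieldI, (1.36)–(1.37) p.184] -/
theorem tilde_le_local {L : ℕ} (hL : 2 ≤ L) {G : Subgroup 𝔸ˣ} (hG : AvgClosed d L G) {j : ℕ}
    {U₀ : Site d → Fin d → 𝔸ˣ} (hU₀ : ∀ x κ, U₀ x κ ∈ G) {α₀ : ℝ} (hα : 0 < α₀) (hα3 : C0 d * α₀ ≤ 1 / 3)
    (hα4 : 4 * α₀ ≤ c2' d L) (h52 : pdev U₀ < α₀ * (((L : ℝ) ^ j)⁻¹) ^ 2)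
    {B : Site d → Fin d → 𝔸} (q : Site d) (κ : Fin d) {bloc : ℝ} (hbloc : 0 ≤ bloc)
    (hB : ∀ y μ, InBox (loK L j q) (bondHiK L j q κ) y → ‖B y μ‖ ≤ bloc)
    (hsmall : Real.exp (4 * (800 * ((d : ℝ) + 1) ^ 2 * ((d : ℝ) + 4)) * α₀)
      * (1 + 8 * (131072 * ((d : ℝ) + 1) ^ 2) * ((L : ℝ) ^ j * bloc)) ≤ 2)
    (hc₃ : 2 * ((L : ℝ) ^ j * bloc) ≤ c3 d L) (hsm : 2048 * (d : ℝ) * ((L : ℝ) ^ j * bloc) ≤ 1)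
    (h1 : 128 * ((L : ℝ) ^ j * bloc) ≤ 1) :
    ‖((avgIter L (expCfg B * U₀) j q κ : 𝔸ˣ) : 𝔸) * (((avgIter L U₀ j q κ)⁻¹ : 𝔸ˣ) : 𝔸) - 1‖
      ≤ 136 * ((d : ℝ) + 1) * ((L : ℝ) ^ j * bloc) := by
  have hL1 : 1 ≤ L := le_trans (by norm_num) hL
  rw [avgIter_expCfg_mul_clamp hL1 j U₀ B q κ]
  exact eq164_general hL hG hU₀ hα hα3 hα4 h52 hbloc (norm_clamp_le hL1 hB) hsmall hc₃ hsm h1 q κ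

/-- **THE TILDE FACTOR OF (1.36)/(1.37) IN PRINT'S LETTERS.**  `B = iξℍ` with `ξ = L^{−j}` (p. 183) and
`s ≥ sup_{B^j(b₋)∪B^j(b₊)}|ℍ|`: `Lʲ·(ξs) = s`, so under (M2)'s regime `|M^j(e^{iξℍ}U₀)(b)·M^j(U₀)(b)⁻¹ − 1| ≤ 136(d+1)·s
≤ 136(d+1)·L·s` — *"|exp iQ̃_j(ξℍ, b)·(frames) − 1| ≦ O(1)L·sup|ℍ|"*, `O(1) = 136(d+1)`. [cite: Balaban1989LargeFieldI, (1.37) p.184] -/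
theorem tilde_le_printed {L : ℕ} (hL : 2 ≤ L) {G : Subgroup 𝔸ˣ} (hG : AvgClosed d L G) {j : ℕ}
    {U₀ : Site d → Fin d → 𝔸ˣ} (hU₀ : ∀ x κ, U₀ x κ ∈ G) {α₀ : ℝ} (hα : 0 < α₀) (hα3 : C0 d * α₀ ≤ 1 / 3)
    (hα4 : 4 * α₀ ≤ c2' d L) (h52 : pdev U₀ < α₀ * (((L : ℝ) ^ j)⁻¹) ^ 2)
    (H : Site d → Fin d → 𝔸) (q : Site d) (κ : Fin d) {s : ℝ} (hs : 0 ≤ s)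
    (hH : ∀ y μ, InBox (loK L j q) (bondHiK L j q κ) y → ‖H y μ‖ ≤ s)
    (hsmall : Real.exp (4 * (800 * ((d : ℝ) + 1) ^ 2 * ((d : ℝ) + 4)) * α₀)
      * (1 + 8 * (131072 * ((d : ℝ) + 1) ^ 2) * s) ≤ 2)
    (hc₃ : 2 * s ≤ c3 d L) (hsm : 2048 * (d : ℝ) * s ≤ 1) (h1 : 128 * s ≤ 1) :
    ‖((avgIter L (expCfg (fun y μ => ((Complex.I : ℂ) * ((((L : ℝ) ^ j)⁻¹ : ℝ) : ℂ)) • H y μ) * U₀) j q κ : 𝔸ˣ) : 𝔸)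
        * (((avgIter L U₀ j q κ)⁻¹ : 𝔸ˣ) : 𝔸) - 1‖
      ≤ 136 * ((d : ℝ) + 1) * s ∧
    ‖((avgIter L (expCfg (fun y μ => ((Complex.I : ℂ) * ((((L : ℝ) ^ j)⁻¹ : ℝ) : ℂ)) • H y μ) * U₀) j q κ : 𝔸ˣ) : 𝔸)
        * (((avgIter L U₀ j q κ)⁻¹ : 𝔸ˣ) : 𝔸) - 1‖
      ≤ 136 * ((d : ℝ) + 1) * L * s := by
  have hL1 : (1 : ℝ) ≤ L := by exact_mod_cast le_trans (by norm_num) hL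
  have hLj : (0 : ℝ) < (L : ℝ) ^ j := by positivity
  set ξ : ℝ := ((L : ℝ) ^ j)⁻¹ with hξ
  have hξ0 : 0 ≤ ξ := inv_nonneg.mpr hLj.le
  -- the local bound of `B = iξH`: `ξ·s`, and `Lʲ·(ξs) = s`
  have hB : ∀ y μ, InBox (loK L j q) (bondHiK L j q κ) y →
      ‖((Complex.I : ℂ) * ((ξ : ℝ) : ℂ)) • H y μ‖ ≤ ξ * s := fun y μ hy => by
    rw [norm_smul, norm_mul, Complex.norm_I, one_mul, Complex.norm_real, Real.norm_of_nonneg hξ0]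
    exact mul_le_mul_of_nonneg_left (hH y μ hy) hξ0
  have hx : (L : ℝ) ^ j * (ξ * s) = s := by
    rw [hξ, ← mul_assoc, mul_inv_cancel₀ hLj.ne', one_mul]
  have h := tilde_le_local hL hG hU₀ hα hα3 hα4 h52 q κ (mul_nonneg hξ0 hs) hB
    (by rw [hx]; exact hsmall) (by rw [hx]; exact hc₃) (by rw [hx]; exact hsm) (by rw [hx]; exact h1)
  rw [hx] at h
  refine ⟨h, h.trans ?_⟩
  have hd : (0 : ℝ) ≤ 136 * ((d : ℝ) + 1) * s := by positivity
  calc 136 * ((d : ℝ) + 1) * s = 136 * ((d : ℝ) + 1) * s * 1 := by ring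
    _ ≤ 136 * ((d : ℝ) + 1) * s * L := mul_le_mul_of_nonneg_left hL1 hd
    _ = 136 * ((d : ℝ) + 1) * L * s := by ring

/-! ## §3 (1.37): assembling the `u_j`-factors of (1.36) -/

omit [NormedAlgebra ℂ 𝔸] [CompleteSpace 𝔸] [NormOneClass 𝔸] in
/-- The unit-ball algebra of (1.36): `|a·T·c − 1| ≤ |a − 1| + |T − 1| + |c − 1| + |T − 1||c − 1|` for `|a| ≤ 1`
(`aTc − 1 = a(Tc − 1) + (a − 1)`, `Tc − 1 = (T − 1)(c − 1) + (T − 1) + (c − 1)`). [folklore] -/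
private theorem norm_mul₃_sub_one_le {a T c : 𝔸} (ha : ‖a‖ ≤ 1) :
    ‖a * T * c - 1‖ ≤ ‖a - 1‖ + ‖T - 1‖ + ‖c - 1‖ + ‖T - 1‖ * ‖c - 1‖ := by
  have h2 := B7Prop6Bound.mul_sub_one_norm_le T c
  have h2' : (1 + ‖T - 1‖) * (1 + ‖c - 1‖) - 1 = ‖T - 1‖ + ‖c - 1‖ + ‖T - 1‖ * ‖c - 1‖ := by ring
  rw [h2'] at h2
  have hid : a * T * c - 1 = a * (T * c - 1) + (a - 1) := by noncomm_ring
  calc ‖a * T * c - 1‖ = ‖a * (T * c - 1) + (a - 1)‖ := by rw [hid]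
    _ ≤ ‖a * (T * c - 1)‖ + ‖a - 1‖ := norm_add_le _ _
    _ ≤ ‖a‖ * ‖T * c - 1‖ + ‖a - 1‖ := by gcongr; exact norm_mul_le _ _
    _ ≤ 1 * ‖T * c - 1‖ + ‖a - 1‖ := by gcongr
    _ ≤ ‖a - 1‖ + ‖T - 1‖ + ‖c - 1‖ + ‖T - 1‖ * ‖c - 1‖ := by linarith

/-- **(1.37)** — `|exp iℍ^{(j)}(b) − 1| ≦ O(1)L·sup_{B^j(b₋)∪B^j(b₊)}|ℍ|` for
`exp iℍ^{(j)}(b) = u_j(b₋)⁻¹·M^j(e^{iξℍ}U₀)(b)·u_j(b₊)·M^j(U₀)(b)⁻¹` ((1.35): `V^{(j)}_{Z_{j+1}∖Z_j} = (M^j(e^{iξℍ}U₀))^{u_j⁻¹}`,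
`V_Z^{(j)} = M^j(U₀)`, `U₀ = U^{(n+1)}_k`), as r12's leaf `Ineq137 |exp iℍ^{(j)}(b) − 1| (272(d+1) + 2C_u) L s`: the tilde
factor by §2 ([12] (159)–(164), PROVED in the tree), the gauge transformation `u_j` of the standard representation
(1.34) through the HYPOTHESIS `|u_j(b_±) − 1| ≤ C_u·L·s ≤ 1` (M3) (`u₁ = u_j(b₋) ∈ U1`, `u₂ = u_j(b₊)`); regime (M2).
[cite: Balaban1989LargeFieldI, (1.35)–(1.37) p.184] -/
theorem ineq137_of_164 {L : ℕ} (hL : 2 ≤ L) {G : Subgroup 𝔸ˣ} (hG : AvgClosed d L G) {j : ℕ}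
    {U₀ : Site d → Fin d → 𝔸ˣ} (hU₀ : ∀ x κ, U₀ x κ ∈ G) {α₀ : ℝ} (hα : 0 < α₀) (hα3 : C0 d * α₀ ≤ 1 / 3)
    (hα4 : 4 * α₀ ≤ c2' d L) (h52 : pdev U₀ < α₀ * (((L : ℝ) ^ j)⁻¹) ^ 2)
    (H : Site d → Fin d → 𝔸) (q : Site d) (κ : Fin d) {s : ℝ} (hs : 0 ≤ s)
    (hH : ∀ y μ, InBox (loK L j q) (bondHiK L j q κ) y → ‖H y μ‖ ≤ s)
    (hsmall : Real.exp (4 * (800 * ((d : ℝ) + 1) ^ 2 * ((d : ℝ) + 4)) * α₀)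
      * (1 + 8 * (131072 * ((d : ℝ) + 1) ^ 2) * s) ≤ 2)
    (hc₃ : 2 * s ≤ c3 d L) (hsm : 2048 * (d : ℝ) * s ≤ 1) (h1 : 128 * s ≤ 1)
    {u₁ u₂ : 𝔸ˣ} (hu₁ : u₁ ∈ U1 𝔸) {Cu : ℝ}
    (hu₁s : ‖(u₁ : 𝔸) - 1‖ ≤ Cu * L * s) (hu₂s : ‖(u₂ : 𝔸) - 1‖ ≤ Cu * L * s) (hCu1 : Cu * L * s ≤ 1) :
    Ineq137
      ‖(((u₁⁻¹ : 𝔸ˣ) : 𝔸)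
          * ((avgIter L (expCfg (fun y μ => ((Complex.I : ℂ) * ((((L : ℝ) ^ j)⁻¹ : ℝ) : ℂ)) • H y μ) * U₀) j q κ
              : 𝔸ˣ) : 𝔸)
          * (u₂ : 𝔸) * (((avgIter L U₀ j q κ)⁻¹ : 𝔸ˣ) : 𝔸)) - 1‖
      (272 * ((d : ℝ) + 1) + 2 * Cu) L s := by
  unfold Ineq137
  obtain ⟨-, ht⟩ := tilde_le_printed hL hG hU₀ hα hα3 hα4 h52 H q κ hs hH hsmall hc₃ hsm h1
  -- the averaged background bond `Ū₀ʲ(b)` is unit-bounded (Prop. 2 at every level `≤ j`, `B7Eq123General.level_data`)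
  have hVU1 : avgIter L U₀ j q κ ∈ U1 𝔸 :=
    (B7Eq123General.level_data L hL hG j U₀ hU₀ hα hα3 hα4 h52 j le_rfl).1 q κ
  set W : 𝔸 := ((avgIter L (expCfg (fun y μ => ((Complex.I : ℂ) * ((((L : ℝ) ^ j)⁻¹ : ℝ) : ℂ)) • H y μ) * U₀)
    j q κ : 𝔸ˣ) : 𝔸) with hW
  set V : 𝔸ˣ := avgIter L U₀ j q κ with hV
  -- rewrite `u₁⁻¹·W·u₂·V⁻¹ = u₁⁻¹·(W V⁻¹)·(V u₂ V⁻¹)`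
  have hid : ((u₁⁻¹ : 𝔸ˣ) : 𝔸) * W * (u₂ : 𝔸) * ((V⁻¹ : 𝔸ˣ) : 𝔸)
      = ((u₁⁻¹ : 𝔸ˣ) : 𝔸) * (W * ((V⁻¹ : 𝔸ˣ) : 𝔸)) * ((V : 𝔸) * (u₂ : 𝔸) * ((V⁻¹ : 𝔸ˣ) : 𝔸)) := by
    have hVV : ((V⁻¹ : 𝔸ˣ) : 𝔸) * (V : 𝔸) = 1 := Units.inv_mul V
    calc ((u₁⁻¹ : 𝔸ˣ) : 𝔸) * W * (u₂ : 𝔸) * ((V⁻¹ : 𝔸ˣ) : 𝔸)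
        = ((u₁⁻¹ : 𝔸ˣ) : 𝔸) * W * (((V⁻¹ : 𝔸ˣ) : 𝔸) * (V : 𝔸)) * (u₂ : 𝔸) * ((V⁻¹ : 𝔸ˣ) : 𝔸) := by
          rw [hVV, mul_one]
      _ = ((u₁⁻¹ : 𝔸ˣ) : 𝔸) * (W * ((V⁻¹ : 𝔸ˣ) : 𝔸)) * ((V : 𝔸) * (u₂ : 𝔸) * ((V⁻¹ : 𝔸ˣ) : 𝔸)) := by
          simp only [mul_assoc]
  rw [hid]
  have ha : ‖((u₁⁻¹ : 𝔸ˣ) : 𝔸)‖ ≤ 1 := (mem_U1.mp hu₁).2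
  have ha1 : ‖((u₁⁻¹ : 𝔸ˣ) : 𝔸) - 1‖ ≤ Cu * L * s := (norm_inv_sub_one_le hu₁).trans hu₁s
  have hc1 : ‖(V : 𝔸) * (u₂ : 𝔸) * ((V⁻¹ : 𝔸ˣ) : 𝔸) - 1‖ ≤ Cu * L * s :=
    (norm_units_conj_sub_one_le hVU1 _).trans hu₂s
  have h3 := norm_mul₃_sub_one_le (T := W * ((V⁻¹ : 𝔸ˣ) : 𝔸)) (c := (V : 𝔸) * (u₂ : 𝔸) * ((V⁻¹ : 𝔸ˣ) : 𝔸)) ha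
  have ht0 : 0 ≤ ‖W * ((V⁻¹ : 𝔸ˣ) : 𝔸) - 1‖ := norm_nonneg _
  -- `|T − 1||c − 1| ≤ |T − 1|·1`
  have hprod : ‖W * ((V⁻¹ : 𝔸ˣ) : 𝔸) - 1‖ * ‖(V : 𝔸) * (u₂ : 𝔸) * ((V⁻¹ : 𝔸ˣ) : 𝔸) - 1‖
      ≤ 136 * ((d : ℝ) + 1) * L * s := by
    calc _ ≤ ‖W * ((V⁻¹ : 𝔸ˣ) : 𝔸) - 1‖ * (Cu * L * s) := mul_le_mul_of_nonneg_left hc1 ht0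
      _ ≤ ‖W * ((V⁻¹ : 𝔸ˣ) : 𝔸) - 1‖ * 1 := mul_le_mul_of_nonneg_left hCu1 ht0
      _ ≤ 136 * ((d : ℝ) + 1) * L * s := by rw [mul_one]; exact ht
  calc _ ≤ ‖((u₁⁻¹ : 𝔸ˣ) : 𝔸) - 1‖ + ‖W * ((V⁻¹ : 𝔸ˣ) : 𝔸) - 1‖
        + ‖(V : 𝔸) * (u₂ : 𝔸) * ((V⁻¹ : 𝔸ˣ) : 𝔸) - 1‖
        + ‖W * ((V⁻¹ : 𝔸ˣ) : 𝔸) - 1‖ * ‖(V : 𝔸) * (u₂ : 𝔸) * ((V⁻¹ : 𝔸ˣ) : 𝔸) - 1‖ := h3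
    _ ≤ Cu * L * s + 136 * ((d : ℝ) + 1) * L * s + Cu * L * s + 136 * ((d : ℝ) + 1) * L * s := by
        linarith [ha1, ht, hc1, hprod]
    _ = (272 * ((d : ℝ) + 1) + 2 * Cu) * L * s := by ring

/-! ## §4 (v1.1) (1.37) for [12]'s gauge fixing: the `u_j`-hypothesis discharged -/

omit [NormOneClass 𝔸] in
/-- **(1.35)/(1.36) in the model** — gauge covariance (70) of the `j`-fold average: for any gauge function `g` of the fine
lattice, `M^j(V^{g})(b)·M^j(U₀)(b)⁻¹ = g(Lʲb₋)·M^j(V)(b)·g(Lʲb₊)⁻¹·M^j(U₀)(b)⁻¹` (`b = ⟨q, q + e_κ⟩`, `g` read at the block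
corners `Lʲq`, `Lʲ(q + e_κ)`); with `V = e^{iξℍ}U₀`, `g = u_j⁻¹` this is `exp iℍ^{(j)}(b) = u_j(b₋)⁻¹·[M^j(e^{iξℍ}U₀)(b)M^j(U₀)(b)⁻¹]·
R̄^j(u_j(b₊))`. [cite: Balaban1989LargeFieldI, (1.35)–(1.36) p.184] -/
theorem avgIter_gaugeAct_ratio (L : ℕ) (g : Site d → 𝔸ˣ) (V U₀ : Site d → Fin d → 𝔸ˣ) (j : ℕ) (q : Site d)
    (κ : Fin d) :
    ((avgIter L (gaugeAct g V) j q κ : 𝔸ˣ) : 𝔸) * (((avgIter L U₀ j q κ)⁻¹ : 𝔸ˣ) : 𝔸)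
      = (g (((L : ℤ) ^ j) • q) : 𝔸) * ((avgIter L V j q κ : 𝔸ˣ) : 𝔸)
          * (((g (((L : ℤ) ^ j) • (q + e κ)))⁻¹ : 𝔸ˣ) : 𝔸) * (((avgIter L U₀ j q κ)⁻¹ : 𝔸ˣ) : 𝔸) := by
  rw [B7Prop6Flat.avgIter_gaugeAct_units]
  simp only [gaugeAct, B7AvgGaugeCovariance.uLev_apply, Units.val_mul, smul_add]

omit [NormedAlgebra ℂ 𝔸] [CompleteSpace 𝔸] in
/-- The unit-ball algebra of (1.36) WITHOUT unitarity of the gauge transformation: for units `u₁, u₂` with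
`|u_i − 1| ≤ y ≤ ½`, `V ∈ U1`, and `|T − 1| ≤ t ≤ 1`:  `|u₁⁻¹·T·(V u₂ V⁻¹) − 1| ≤ t + 8y`
(`|u₁⁻¹ − 1| ≤ 2y`, `|V u₂ V⁻¹ − 1| ≤ y`, `(1 + 2y)(1 + t)(1 + y) − 1 ≤ t + 8y`). [folklore] -/
private theorem dev_le_of_norm_sub_one_le {u₁ u₂ V : 𝔸ˣ} {T : 𝔸} {y t : ℝ} (hV : V ∈ U1 𝔸)
    (hu₁ : ‖(u₁ : 𝔸) - 1‖ ≤ y) (hu₂ : ‖(u₂ : 𝔸) - 1‖ ≤ y) (hy : y ≤ 1 / 2) (hT : ‖T - 1‖ ≤ t) (ht1 : t ≤ 1) :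
    ‖((u₁⁻¹ : 𝔸ˣ) : 𝔸) * T * ((V : 𝔸) * (u₂ : 𝔸) * ((V⁻¹ : 𝔸ˣ) : 𝔸)) - 1‖ ≤ t + 8 * y := by
  have hy0 : 0 ≤ y := (norm_nonneg _).trans hu₁
  have ht0 : 0 ≤ t := (norm_nonneg _).trans hT
  have ha : ‖((u₁⁻¹ : 𝔸ˣ) : 𝔸) - 1‖ ≤ 2 * y :=
    (B7Prop6Flat.norm_units_inv_sub_one_le u₁ (hu₁.trans hy)).trans (by linarith)
  have hc : ‖(V : 𝔸) * (u₂ : 𝔸) * ((V⁻¹ : 𝔸ˣ) : 𝔸) - 1‖ ≤ y := (norm_units_conj_sub_one_le hV _).trans hu₂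
  have h1 := B7Prop6Bound.mul_sub_one_norm_le ((u₁⁻¹ : 𝔸ˣ) : 𝔸) T
  have h2 := B7Prop6Bound.mul_sub_one_norm_le (((u₁⁻¹ : 𝔸ˣ) : 𝔸) * T)
    ((V : 𝔸) * (u₂ : 𝔸) * ((V⁻¹ : 𝔸ˣ) : 𝔸))
  have h1' : 1 + ‖((u₁⁻¹ : 𝔸ˣ) : 𝔸) * T - 1‖ ≤ (1 + 2 * y) * (1 + t) := by
    have := mul_le_mul (add_le_add_left ha 1) (add_le_add_left hT 1) (by positivity) (by positivity)
    linarith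
  have h2' : 1 + ‖((u₁⁻¹ : 𝔸ˣ) : 𝔸) * T * ((V : 𝔸) * (u₂ : 𝔸) * ((V⁻¹ : 𝔸ˣ) : 𝔸)) - 1‖
      ≤ (1 + 2 * y) * (1 + t) * (1 + y) := by
    have := mul_le_mul h1' (add_le_add_left hc 1) (by positivity) (by positivity)
    linarith
  have key : (1 + 2 * y) * (1 + t) * (1 + y) - 1 ≤ t + 8 * y := by
    nlinarith [mul_nonneg (mul_nonneg hy0 (sub_nonneg.2 hy)) (show (0 : ℝ) ≤ 1 + t by linarith),
      mul_nonneg hy0 (sub_nonneg.2 ht1)]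
  linarith

/-- **THE STANDARD-REPRESENTATION DEVIATION, generic exponent field.**  Regime (M2) for `U₀` at level `j`; `B` an exponent
field with GLOBAL bound `|B| ≤ b` and `x := Lʲb` satisfying the four smallness conditions of `eq164_general`; `u := glev(U₀, e^{B})`
= the gauge transformation (104)–(106) of [12] for the small field `e^{B}` at the background `U₀`.  Then
`|M^j((e^{B}U₀)^{u⁻¹})(b)·M^j(U₀)(b)⁻¹ − 1| ≤ (136(d+1) + 320d)·Lʲb`: tilde factor `136(d+1)·Lʲb` ([12] (164), §2), gauge
fixing `|u(Lʲb_±) − 1| ≤ 40d·Lʲb` ([12] (166) at `j = 0` at a general background, `B7Eq167General.norm_glev_sub_one_le`),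
unit-ball algebra without unitarity of `u`.  The instances: (1.37) below (`B = iξℍ`, `ξ = L^{−j}`), and [III] (3.19) /
[IV] (1.42) (`B = iL⁻¹ξ𝐇_{j+1,□′}`). [cite: Balaban1989LargeFieldI, (1.34)–(1.37) p.184] -/
theorem stdRep_dev_le {L : ℕ} (hL : 2 ≤ L) {G : Subgroup 𝔸ˣ} (hG : AvgClosed d L G) {j : ℕ}
    {U₀ : Site d → Fin d → 𝔸ˣ} (hU₀ : ∀ x κ, U₀ x κ ∈ G) {α₀ : ℝ} (hα : 0 < α₀) (hα3 : C0 d * α₀ ≤ 1 / 3)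
    (hα4 : 4 * α₀ ≤ c2' d L) (h52 : pdev U₀ < α₀ * (((L : ℝ) ^ j)⁻¹) ^ 2)
    (B : Site d → Fin d → 𝔸) (q : Site d) (κ : Fin d) {b : ℝ} (hb : 0 ≤ b) (hB : ∀ y μ, ‖B y μ‖ ≤ b)
    (hsmall : Real.exp (4 * (800 * ((d : ℝ) + 1) ^ 2 * ((d : ℝ) + 4)) * α₀)
      * (1 + 8 * (131072 * ((d : ℝ) + 1) ^ 2) * ((L : ℝ) ^ j * b)) ≤ 2)
    (hc₃ : 2 * ((L : ℝ) ^ j * b) ≤ c3 d L) (hsm : 2048 * (d : ℝ) * ((L : ℝ) ^ j * b) ≤ 1)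
    (h1 : 128 * ((L : ℝ) ^ j * b) ≤ 1) (hL1 : 1 ≤ L) :
    ‖((avgIter L (gaugeAct (B7Eq84Concrete.glev L hL1 U₀ (expCfg B) j 0)⁻¹ (expCfg B * U₀)) j q κ : 𝔸ˣ) : 𝔸)
        * (((avgIter L U₀ j q κ)⁻¹ : 𝔸ˣ) : 𝔸) - 1‖ ≤ (136 * ((d : ℝ) + 1) + 320 * d) * ((L : ℝ) ^ j * b) := by
  have hd : (0 : ℝ) ≤ d := Nat.cast_nonneg d
  have hx0 : (0 : ℝ) ≤ (L : ℝ) ^ j * b := by positivity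
  set u : Site d → 𝔸ˣ := B7Eq84Concrete.glev L hL1 U₀ (expCfg B) j 0 with hudef
  -- the tilde factor ([12] (164) at a general background; the global bound is a local bound)
  have ht := tilde_le_local hL hG hU₀ hα hα3 hα4 h52 q κ hb (fun y μ _ => hB y μ) hsmall hc₃ hsm h1
  -- the gauge fixing ([12] (166) at `j = 0`, general background)
  have hds : 128 * (d : ℝ) * ((L : ℝ) ^ j * b) ≤ 1 := by nlinarith
  have hu : ∀ x, ‖((u x : 𝔸ˣ) : 𝔸) - 1‖ ≤ 40 * d * ((L : ℝ) ^ j * b) := fun x =>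
    B7Eq167General.norm_glev_sub_one_le hL hG hU₀ hα hα3 hα4 h52 hb hB hsmall hc₃ hds hL1 x
  -- the averaged background bond is unit-bounded
  have hVU1 : avgIter L U₀ j q κ ∈ U1 𝔸 :=
    (B7Eq123General.level_data L hL hG j U₀ hU₀ hα hα3 hα4 h52 j le_rfl).1 q κ
  -- (1.35)/(1.36): the quantity is `u(Lʲq)⁻¹·W·u(Lʲ(q+e_κ))·V⁻¹ = u₁⁻¹·(W V⁻¹)·(V u₂ V⁻¹)`
  rw [avgIter_gaugeAct_ratio]
  simp only [Pi.inv_apply, inv_inv]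
  set W : 𝔸 := ((avgIter L (expCfg B * U₀) j q κ : 𝔸ˣ) : 𝔸) with hW
  set V : 𝔸ˣ := avgIter L U₀ j q κ with hV
  set u₁ : 𝔸ˣ := u (((L : ℤ) ^ j) • q) with hu₁
  set u₂ : 𝔸ˣ := u (((L : ℤ) ^ j) • (q + e κ)) with hu₂
  have hid : ((u₁⁻¹ : 𝔸ˣ) : 𝔸) * W * (u₂ : 𝔸) * ((V⁻¹ : 𝔸ˣ) : 𝔸)
      = ((u₁⁻¹ : 𝔸ˣ) : 𝔸) * (W * ((V⁻¹ : 𝔸ˣ) : 𝔸)) * ((V : 𝔸) * (u₂ : 𝔸) * ((V⁻¹ : 𝔸ˣ) : 𝔸)) := by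
    have hVV : ((V⁻¹ : 𝔸ˣ) : 𝔸) * (V : 𝔸) = 1 := Units.inv_mul V
    calc ((u₁⁻¹ : 𝔸ˣ) : 𝔸) * W * (u₂ : 𝔸) * ((V⁻¹ : 𝔸ˣ) : 𝔸)
        = ((u₁⁻¹ : 𝔸ˣ) : 𝔸) * W * (((V⁻¹ : 𝔸ˣ) : 𝔸) * (V : 𝔸)) * (u₂ : 𝔸) * ((V⁻¹ : 𝔸ˣ) : 𝔸) := by
          rw [hVV, mul_one]
      _ = ((u₁⁻¹ : 𝔸ˣ) : 𝔸) * (W * ((V⁻¹ : 𝔸ˣ) : 𝔸)) * ((V : 𝔸) * (u₂ : 𝔸) * ((V⁻¹ : 𝔸ˣ) : 𝔸)) := by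
          simp only [mul_assoc]
  rw [hid]
  -- `t = 136(d+1)x ≤ 1` (from the (123)-route smallness) and `y = 40dx ≤ ½`
  have ht1 : 136 * ((d : ℝ) + 1) * ((L : ℝ) ^ j * b) ≤ 1 := by
    have hexp : (1 : ℝ) ≤ Real.exp (4 * (800 * ((d : ℝ) + 1) ^ 2 * ((d : ℝ) + 4)) * α₀) :=
      Real.one_le_exp (by positivity)
    have h0 : (0 : ℝ) ≤ 1 + 8 * (131072 * ((d : ℝ) + 1) ^ 2) * ((L : ℝ) ^ j * b) := by positivity
    have h2 := mul_le_mul_of_nonneg_right hexp h0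
    nlinarith
  have hy : 40 * (d : ℝ) * ((L : ℝ) ^ j * b) ≤ 1 / 2 := by nlinarith
  have hdev := dev_le_of_norm_sub_one_le (u₁ := u₁) (u₂ := u₂) (T := W * ((V⁻¹ : 𝔸ˣ) : 𝔸)) hVU1
    (hu (((L : ℤ) ^ j) • q)) (hu (((L : ℤ) ^ j) • (q + e κ))) hy ht ht1
  exact hdev.trans (le_of_eq (by ring))

/-- **(1.37) WITH THE `u_j`-HYPOTHESIS DISCHARGED, for [12]'s gauge fixing.**  Regime (M2) for `U₀ = U^{(n+1)}_k` at level `j`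
and `s ≥ sup|ℍ|` (global, (M5′)); `ξ = L^{−j}`, `B = iξℍ`; `u := glev(U₀, e^{B})` = the gauge transformation (104)–(106) of [12]
for the small field `e^{iξℍ}` (READING (M3′)).  Then the (1.36)-quantity `exp iℍ^{(j)}(b) = M^j((e^{iξℍ}U₀)^{u⁻¹})(b)·M^j(U₀)(b)⁻¹`
satisfies `|exp iℍ^{(j)}(b) − 1| ≤ (136(d+1) + 320d)·s` (`stdRep_dev_le` with `Lʲ·ξs = s`), hence r12's leaf
`Ineq137 dev (68 + 228d) L s` (`L ≥ 2`; print: `O(1)L·sup|ℍ|`). [cite: Balaban1989LargeFieldI, (1.35)–(1.37) p.184] -/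
theorem ineq137_glev {L : ℕ} (hL : 2 ≤ L) {G : Subgroup 𝔸ˣ} (hG : AvgClosed d L G) {j : ℕ}
    {U₀ : Site d → Fin d → 𝔸ˣ} (hU₀ : ∀ x κ, U₀ x κ ∈ G) {α₀ : ℝ} (hα : 0 < α₀) (hα3 : C0 d * α₀ ≤ 1 / 3)
    (hα4 : 4 * α₀ ≤ c2' d L) (h52 : pdev U₀ < α₀ * (((L : ℝ) ^ j)⁻¹) ^ 2)
    (H : Site d → Fin d → 𝔸) (q : Site d) (κ : Fin d) {s : ℝ} (hs : 0 ≤ s) (hH : ∀ y μ, ‖H y μ‖ ≤ s)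
    (hsmall : Real.exp (4 * (800 * ((d : ℝ) + 1) ^ 2 * ((d : ℝ) + 4)) * α₀)
      * (1 + 8 * (131072 * ((d : ℝ) + 1) ^ 2) * s) ≤ 2)
    (hc₃ : 2 * s ≤ c3 d L) (hsm : 2048 * (d : ℝ) * s ≤ 1) (h1 : 128 * s ≤ 1) (hL1 : 1 ≤ L) :
    ‖((avgIter L
          (gaugeAct (B7Eq84Concrete.glev L hL1 U₀
              (expCfg (fun y μ => ((Complex.I : ℂ) * ((((L : ℝ) ^ j)⁻¹ : ℝ) : ℂ)) • H y μ)) j 0)⁻¹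
            (expCfg (fun y μ => ((Complex.I : ℂ) * ((((L : ℝ) ^ j)⁻¹ : ℝ) : ℂ)) • H y μ) * U₀)) j q κ : 𝔸ˣ) : 𝔸)
        * (((avgIter L U₀ j q κ)⁻¹ : 𝔸ˣ) : 𝔸) - 1‖ ≤ (136 * ((d : ℝ) + 1) + 320 * d) * s ∧
    Ineq137
      ‖((avgIter L
          (gaugeAct (B7Eq84Concrete.glev L hL1 U₀
              (expCfg (fun y μ => ((Complex.I : ℂ) * ((((L : ℝ) ^ j)⁻¹ : ℝ) : ℂ)) • H y μ)) j 0)⁻¹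
            (expCfg (fun y μ => ((Complex.I : ℂ) * ((((L : ℝ) ^ j)⁻¹ : ℝ) : ℂ)) • H y μ) * U₀)) j q κ : 𝔸ˣ) : 𝔸)
        * (((avgIter L U₀ j q κ)⁻¹ : 𝔸ˣ) : 𝔸) - 1‖
      (68 + 228 * (d : ℝ)) L s := by
  have hLr : (2 : ℝ) ≤ L := by exact_mod_cast hL
  have hLj : (0 : ℝ) < (L : ℝ) ^ j := by positivity
  have hd : (0 : ℝ) ≤ d := Nat.cast_nonneg d
  set ξ : ℝ := ((L : ℝ) ^ j)⁻¹ with hξ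
  have hξ0 : 0 ≤ ξ := inv_nonneg.mpr hLj.le
  -- the exponent field `B = iξℍ` is bounded by `ξs`, and `Lʲ·(ξs) = s`
  have hB : ∀ y μ, ‖((Complex.I : ℂ) * ((ξ : ℝ) : ℂ)) • H y μ‖ ≤ ξ * s := fun y μ => by
    rw [norm_smul, norm_mul, Complex.norm_I, one_mul, Complex.norm_real, Real.norm_of_nonneg hξ0]
    exact mul_le_mul_of_nonneg_left (hH y μ) hξ0
  have hx : (L : ℝ) ^ j * (ξ * s) = s := by
    rw [hξ, ← mul_assoc, mul_inv_cancel₀ hLj.ne', one_mul]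
  have h := stdRep_dev_le hL hG hU₀ hα hα3 hα4 h52 (fun y μ => ((Complex.I : ℂ) * ((ξ : ℝ) : ℂ)) • H y μ) q κ
    (mul_nonneg hξ0 hs) hB (by rw [hx]; exact hsmall) (by rw [hx]; exact hc₃) (by rw [hx]; exact hsm)
    (by rw [hx]; exact h1) hL1
  rw [hx] at h
  refine ⟨h, ?_⟩
  unfold Ineq137
  refine h.trans ?_
  have h0 : (0 : ℝ) ≤ (136 * ((d : ℝ) + 1) + 320 * d) * s := by positivity
  nlinarith

end Literature.MathematicalPhysics.QuantumFieldTheory.Balaban1983to89.B15Ineq137Proof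

end
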